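import Summits.CriticalPhenomena.CardyFormulaZ2.Theorems.CardyBoundaryCoulombGasHalfPlaneMarkDensityLawNoFreeConstant

/-!
# `HalfPlaneMarkDensityLaw` (crux stmt-CriticalPhenomena-5661), line `Sketch`, proportionality:
# stub `stub_prop_wired` (P2) — the wired three-mark kernel along `θ` tends to `m(σ)·F(x/(x+σ))`

If along a strictly increasing `θ` the collinear four-mark crossing probabilities
`P_{θ n}(a,b,c,y)` converge on the chamber `a < b < c < y` to `G a b c y = m(c − b)·F(η(a,b,c,y))`
with `m` continuous on `(0,∞)`, then the wired three-mark kernel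
`P_{1/2}[(−∞,−⌊σ θn⌋]×{0} ↔ [1,⌊x θn⌋]×{0} in ℤ×ℕ]` converges along `θ` to `m(σ)·F(x/(x+σ))`.

This is the sandwich of `…WiredCardy` (`WiredCardy.le_wired` / `WiredCardy.wired_le` +
`WiredCardy.escape_le'`, and `BoxExhaustion.tendsto_of_sandwich`), run along `θ` exactly as in
`NoFreeConstant.tendsto_wired_subseq`; the only change is that the lower comparison configuration
`(−M, −σ, 1/M, x)` has gap `σ + 1/M` and the upper one `(−M, −σ + 1/M, 0, x)` has gap `σ − 1/M`, so
the comparison limits are `m(σ ± 1/M)·F(η_{lo/hi}(M))`, and the continuity of `m` at `σ`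
(`ContinuousOn m (Ioi 0)`) absorbs the `±1/M` change of the gap as `M → ∞`.
-/

noncomputable section

namespace Summit.CriticalPhenomena.CardyFormulaZ2.Cruxes.HalfPlaneMarkDensityLaw.SketchLine

open Literature.Probability.Percolation Literature.Probability.LatticeModels
open Literature.Probability.RandomPlanarGeometry (crossRatio)
open MeasureTheory Filter Set
open scoped Topology
open Summit.CriticalPhenomena.CardyFormulaZ2.Theorems.HalfPlaneMarkDensityLaw.Negative

namespace Proportional

/-- The lower gap `1/M − (−σ) → σ` as `M → ∞`. [folklore] -/
lemma tendsto_gap_lo (σ : ℝ) : Tendsto (fun M : ℕ ↦ (M : ℝ)⁻¹ - -σ) atTop (𝓝 σ) := by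
  have h : Tendsto (fun M : ℕ ↦ (M : ℝ)⁻¹ - -σ) atTop (𝓝 (0 - -σ)) :=
    (tendsto_inv_atTop_nhds_zero_nat (𝕜 := ℝ)).sub_const (-σ)
  rwa [show (0 : ℝ) - -σ = σ by ring] at h

/-- The upper gap `0 − (−σ + 1/M) → σ` as `M → ∞`. [folklore] -/
lemma tendsto_gap_hi (σ : ℝ) : Tendsto (fun M : ℕ ↦ (0 : ℝ) - (-σ + (M : ℝ)⁻¹)) atTop (𝓝 σ) := by
  have h : Tendsto (fun M : ℕ ↦ (0 : ℝ) - (-σ + (M : ℝ)⁻¹)) atTop (𝓝 (0 - (-σ + 0))) :=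
    ((tendsto_inv_atTop_nhds_zero_nat (𝕜 := ℝ)).const_add (-σ)).const_sub 0
  rwa [show (0 : ℝ) - (-σ + 0) = σ by ring] at h

/-- STUB P2: then the wired three-mark kernel tends along `θ` to `m(σ)·F(x/(x+σ))` (the sandwich of
`…WiredCardy` run along `θ`, as in `NoFreeConstant.tendsto_wired_subseq`, the continuity of `m` at `σ`
absorbing the `±1/M` change of the gap of the comparison configurations). [folklore] -/
theorem stub_prop_wired :
    ∀ {θ : ℕ → ℕ} {G : ℝ → ℝ → ℝ → ℝ → ℝ},
      (∀ a b c y : ℝ, a < b → b < c → c < y →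
        Tendsto (fun n ↦ μ.real (openCrossing halfPlane (arcA a b (θ n))
          (rowIcc ⌊c * (θ n : ℕ)⌋ ⌊y * (θ n : ℕ)⌋))) atTop (𝓝 (G a b c y))) →
      StrictMono θ → ∀ (mfun : ℝ → ℝ), ContinuousOn mfun (Set.Ioi 0) →
      (∀ a b c y : ℝ, a < b → b < c → c < y → G a b c y = mfun (c - b) * Literature.Probability.RandomPlanarGeometry.cardyFunction (crossRatio ![a, b, c, y])) →
      (∀ σ x : ℝ, 0 < σ → 0 < x →
        Tendsto (fun n ↦ μ.real (openCrossing halfPlane {v : Site 2 | v 1 = 0 ∧ v 0 ≤ -⌊σ * (θ n : ℕ)⌋}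
          {v : Site 2 | v 1 = 0 ∧ 1 ≤ v 0 ∧ v 0 ≤ ⌊x * (θ n : ℕ)⌋})) atTop (𝓝 (mfun σ * Literature.Probability.RandomPlanarGeometry.cardyFunction (x / (x + σ))))) := by
  intro θ G hG hθ mfun hm hGm σ x hσ hx
  obtain ⟨C, α, _hC0, hα, hesc⟩ := exists_real_boxToFar_le_rpow_of_le_half
  set L := mfun σ * Literature.Probability.RandomPlanarGeometry.cardyFunction (x / (x + σ)) with hL
  have hX : 1 ≤ ⌈x⌉₊ := Nat.one_le_iff_ne_zero.2 (by simpa using hx)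
  -- continuity of `m` at `σ` absorbs the `±1/M` change of the gap
  have hmσ : ContinuousAt mfun σ := hm.continuousAt (Ioi_mem_nhds hσ)
  have hlo : Tendsto (fun M : ℕ ↦ mfun ((M : ℝ)⁻¹ - -σ)) atTop (𝓝 (mfun σ)) :=
    hmσ.tendsto.comp (tendsto_gap_lo σ)
  have hhi : Tendsto (fun M : ℕ ↦ mfun ((0 : ℝ) - (-σ + (M : ℝ)⁻¹))) atTop (𝓝 (mfun σ)) :=
    hmσ.tendsto.comp (tendsto_gap_hi σ)
  refine BoxExhaustion.tendsto_of_sandwich fun ε hε ↦ ?_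
  -- choose `M`
  have e1 : ∀ᶠ M : ℕ in atTop, L - ε < mfun ((M : ℝ)⁻¹ - -σ) *
      Literature.Probability.RandomPlanarGeometry.cardyFunction (crossRatio ![-(M : ℝ), -σ, (M : ℝ)⁻¹, x]) :=
    (hlo.mul (WiredCardy.tendsto_cardy_lo hσ hx)) (Ioi_mem_nhds (by linarith))
  have e2 : ∀ᶠ M : ℕ in atTop, mfun ((0 : ℝ) - (-σ + (M : ℝ)⁻¹)) *
      Literature.Probability.RandomPlanarGeometry.cardyFunction (crossRatio ![-(M : ℝ), -σ + (M : ℝ)⁻¹, 0, x]) < L + ε :=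
    (hhi.mul (WiredCardy.tendsto_cardy_hi hσ hx)) (Iio_mem_nhds (by linarith))
  have e3 : ∀ᶠ M : ℕ in atTop, C * ((⌈x⌉₊ : ℝ) / M) ^ α < ε :=
    (WiredCardy.tendsto_escapeBound C hα ⌈x⌉₊) (Iio_mem_nhds hε)
  have e4 : ∀ᶠ M : ℕ in atTop, (M : ℝ)⁻¹ < min σ x :=
    (tendsto_inv_atTop_nhds_zero_nat (𝕜 := ℝ)) (Iio_mem_nhds (lt_min hσ hx))
  have e5 : ∀ᶠ M : ℕ in atTop, σ < M := (tendsto_natCast_atTop_atTop (R := ℝ)).eventually_gt_atTop σ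
  obtain ⟨M, hM1, hM2, hM3, hM4, hM5, hMX⟩ :=
    (e1.and (e2.and (e3.and (e4.and (e5.and (eventually_ge_atTop ⌈x⌉₊)))))).exists
  have hM : 0 < M := lt_of_lt_of_le (by omega) hMX
  have hM' : (0 : ℝ) < M := by exact_mod_cast hM
  have hMσ : (M : ℝ)⁻¹ < σ := lt_of_lt_of_le hM4 (min_le_left _ _)
  have hMx : (M : ℝ)⁻¹ < x := lt_of_lt_of_le hM4 (min_le_right _ _)
  have h1lo : -(M : ℝ) < -σ := by linarith
  have h2lo : -σ < (M : ℝ)⁻¹ := by linarith [inv_pos.2 hM']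
  have h1hi : -(M : ℝ) < -σ + (M : ℝ)⁻¹ := by linarith [inv_pos.2 hM']
  have h2hi : -σ + (M : ℝ)⁻¹ < 0 := by linarith
  -- the sandwich along `θ`
  refine ⟨fun n ↦ μ.real (openCrossing halfPlane (arcA (-(M : ℝ)) (-σ) (θ n))
      (rowIcc ⌊(M : ℝ)⁻¹ * (θ n : ℕ)⌋ ⌊x * (θ n : ℕ)⌋)),
    fun n ↦ μ.real (openCrossing halfPlane (arcA (-(M : ℝ)) (-σ + (M : ℝ)⁻¹) (θ n))
      (rowIcc ⌊(0 : ℝ) * (θ n : ℕ)⌋ ⌊x * (θ n : ℕ)⌋)), _, _,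
    hG _ _ _ _ h1lo h2lo hMx, hG _ _ _ _ h1hi h2hi hx, ?_, ?_, ?_⟩
  · rw [hGm _ _ _ _ h1lo h2lo hMx]
    exact hM1
  · rw [hGm _ _ _ _ h1hi h2hi hx]
    exact hM2
  filter_upwards [eventually_ge_atTop (max M 1)] with n hn
  have hn' : max M 1 ≤ θ n := hn.trans (hθ.id_le n)
  have hnM : M ≤ θ n := le_of_max_le_left hn'
  have hn1 : 1 ≤ θ n := le_of_max_le_right hn'
  refine ⟨WiredCardy.le_wired σ x hM hnM, (WiredCardy.wired_le σ x hM hnM).trans ?_⟩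
  have := WiredCardy.escape_le' hesc x hX hMX hn1
  linarith

end Proportional

end Summit.CriticalPhenomena.CardyFormulaZ2.Cruxes.HalfPlaneMarkDensityLaw.SketchLine
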